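import Literature.MathematicalPhysics.QuantumFieldTheory.WilsonFinTorusPartition
import HarnessLib

/-!
# Flat lattice gauge fields with an ABELIAN gauge group on the `Fin`-torus, I: propagation of flatness (helper for stmt-QuantumFields-26930)

Combinatorial companion of `Theorems/IR/ColdDefectFreezingLimit.lean` (p783777; LEAD prover `ymfull-r2c-lead-1` g0, cell `ym-gapexp`,
`--supports stmt-QuantumFields-26930`).  There, THE NUMBER's currency `coldDefect ρ β L` is shown to FREEZE at every fixed box as `β → ∞` onto
the ratio of product-Haar volumes of FLAT gauge fields (all plaquette holonomies trivial) of the two tori `L³ × 2⌊L/4⌋` and `L³ × ⌊L/4⌋`; for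
a finite gauge group the volumes are counts.  This file and its sequel COUNT the flat fields for a finite ABELIAN group: `#Flat = |G|^{V+3}`
(`V` = number of sites), i.e. gauge orbits `|G|^{V−1}` times 't Hooft's flux sectors `Hom(ℤ⁴, G) = G⁴` — so that the freezing limit is
`1 − |G|⁻³` at EVERY box.  Part I (this file, group theory only — `[CommGroup G]`, no topology, no measure):

* elementary torus geometry on `FinTorusSite (m₀+1) (m₁+1) (m₂+1) (m₃+1)` (shifts as `+1` in `Fin (m+1)`, coordinate bookkeeping);
* `eq_of_forall_finRotate` / `indep₀…indep₃` — a function invariant under the unit shift in one coordinate does not depend on it;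
* `apply_shift_eq_of_axis_trivial` — for a flat field whose axis-`ν` links are all trivial, every link variable is invariant under the `ν`-shift;
* LADDER LEMMAS `line₀_shift₁ … line₂_shift₃` — for a flat field the holonomy of an axis-`μ` loop does not change under a transverse unit shift
  (product of the plaquettes of the ladder between the two loops; abelian group);
* `eq_one_of_flat_of_comb` — **PROPAGATION**: a flat field which is trivial on the comb spanning tree (axis-0 links off the `0`-seam; axis-1
  links on the slice `x₀ = 0` off the `1`-seam; axis-2 links on `x₀ = x₁ = 0` off the `2`-seam; axis-3 links on `x₀ = x₁ = x₂ = 0` off the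
  `3`-seam) AND on the four seam links of the base lines is trivial everywhere.  This is the injectivity half of the count (a flat field is
  determined by `V + 3` link variables); Part II builds the gauge × twist parametrisation and concludes `#Flat = |G|^{V+3}`.

Def-free (all objects written inline).  HONEST FRAMING: finite-group lattice combinatorics (BC5 ∕ calibration side of the crux `IRcof`);
nothing here proves `PinnedExitsCofinalAt`, `IRcof`, `IR`, or the Yang–Mills mass gap.  Reference for the statement counted:
G. 't Hooft, Nucl. Phys. B153 (1979) 141, §§2–4 (flux sectors of gauge fields on the torus); the lattice bookkeeping is folklore.
-/

set_option autoImplicit false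

open Literature.MathematicalPhysics.QuantumFieldTheory

namespace Summit.QuantumFields.YangMills.Cruxes.IR.FreezingLimit

variable {G : Type} [CommGroup G] {m₀ m₁ m₂ m₃ : ℕ}

/-! ## §1 Torus geometry: the unit shifts in coordinates -/

section Geometry

variable (x : FinTorusSite (m₀ + 1) (m₁ + 1) (m₂ + 1) (m₃ + 1))

/-- The unit shift in direction `0` adds `1` to the first coordinate. -/
@[simp] theorem shift_zero_eq : x.shift 0 = (x.1 + 1, x.2.1, x.2.2.1, x.2.2.2) := by
  simp [FinTorusSite.shift]

/-- The unit shift in direction `1` adds `1` to the second coordinate. -/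
@[simp] theorem shift_one_eq : x.shift 1 = (x.1, x.2.1 + 1, x.2.2.1, x.2.2.2) := by
  simp [FinTorusSite.shift]

/-- The unit shift in direction `2` adds `1` to the third coordinate. -/
@[simp] theorem shift_two_eq : x.shift 2 = (x.1, x.2.1, x.2.2.1 + 1, x.2.2.2) := by
  simp [FinTorusSite.shift]

/-- The unit shift in direction `3` adds `1` to the fourth coordinate. -/
@[simp] theorem shift_three_eq : x.shift 3 = (x.1, x.2.1, x.2.2.1, x.2.2.2 + 1) := by
  simp [FinTorusSite.shift]

end Geometry

/-! ## §2 Invariance under a unit shift means independence of that coordinate -/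

/-- A function on `Fin (m+1)` invariant under `i ↦ i + 1` is constant. -/
theorem eq_of_forall_add_one {α : Type} {m : ℕ} (f : Fin (m + 1) → α) (h : ∀ i, f (i + 1) = f i) (i : Fin (m + 1)) :
    f i = f 0 := by
  induction i using Fin.induction with
  | zero => rfl
  | succ j ih => rw [← Fin.coeSucc_eq_succ, h, ih]

/-- Independence of the first coordinate from invariance under the `0`-shift. -/
theorem indep₀ {α : Type} (f : FinTorusSite (m₀ + 1) (m₁ + 1) (m₂ + 1) (m₃ + 1) → α) (h : ∀ x, f (x.shift 0) = f x)
    (x : FinTorusSite (m₀ + 1) (m₁ + 1) (m₂ + 1) (m₃ + 1)) : f x = f (0, x.2.1, x.2.2.1, x.2.2.2) := by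
  obtain ⟨a, b, c, d⟩ := x
  have := eq_of_forall_add_one (fun i => f (i, b, c, d)) (fun i => by simpa using h (i, b, c, d)) a
  simpa using this

/-- Independence of the second coordinate from invariance under the `1`-shift. -/
theorem indep₁ {α : Type} (f : FinTorusSite (m₀ + 1) (m₁ + 1) (m₂ + 1) (m₃ + 1) → α) (h : ∀ x, f (x.shift 1) = f x)
    (x : FinTorusSite (m₀ + 1) (m₁ + 1) (m₂ + 1) (m₃ + 1)) : f x = f (x.1, 0, x.2.2.1, x.2.2.2) := by
  obtain ⟨a, b, c, d⟩ := x
  have := eq_of_forall_add_one (fun i => f (a, i, c, d)) (fun i => by simpa using h (a, i, c, d)) b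
  simpa using this

/-- Independence of the third coordinate from invariance under the `2`-shift. -/
theorem indep₂ {α : Type} (f : FinTorusSite (m₀ + 1) (m₁ + 1) (m₂ + 1) (m₃ + 1) → α) (h : ∀ x, f (x.shift 2) = f x)
    (x : FinTorusSite (m₀ + 1) (m₁ + 1) (m₂ + 1) (m₃ + 1)) : f x = f (x.1, x.2.1, 0, x.2.2.2) := by
  obtain ⟨a, b, c, d⟩ := x
  have := eq_of_forall_add_one (fun i => f (a, b, i, d)) (fun i => by simpa using h (a, b, i, d)) c
  simpa using this

/-- Independence of the fourth coordinate from invariance under the `3`-shift. -/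
theorem indep₃ {α : Type} (f : FinTorusSite (m₀ + 1) (m₁ + 1) (m₂ + 1) (m₃ + 1) → α) (h : ∀ x, f (x.shift 3) = f x)
    (x : FinTorusSite (m₀ + 1) (m₁ + 1) (m₂ + 1) (m₃ + 1)) : f x = f (x.1, x.2.1, x.2.2.1, 0) := by
  obtain ⟨a, b, c, d⟩ := x
  have := eq_of_forall_add_one (fun i => f (a, b, c, i)) (fun i => by simpa using h (a, b, c, i)) d
  simpa using this

/-! ## §3 Plaquette algebra in an abelian group -/

/-- In an abelian group: from a trivial plaquette `A·B·C⁻¹·D⁻¹ = 1` with equal rungs `B = D` conclude `A = C`. -/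
theorem eq_of_plaquette_eq_one {A B C D : G} (h : A * B * C⁻¹ * D⁻¹ = 1) (hBD : B = D) : A = C := by
  subst hBD
  rw [mul_inv_eq_one, mul_inv_eq_iff_eq_mul, mul_comm B C] at h
  exact mul_right_cancel h

/-- **Transverse invariance.**  If every plaquette of `U` is trivial and every axis-`ν` link of `U` is trivial, then every link variable
is invariant under the unit shift in direction `ν`. -/
theorem apply_shift_eq_of_axis_trivial {n₀ n₁ n₂ n₃ : ℕ} (U : FinTorusSite n₀ n₁ n₂ n₃ × Fin 4 → G)
    (hflat : ∀ x μ ν, finTorusPlaquette U x μ ν = 1) (ν : Fin 4) (hν : ∀ x, U (x, ν) = 1)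
    (x : FinTorusSite n₀ n₁ n₂ n₃) (μ : Fin 4) : U (x.shift ν, μ) = U (x, μ) := by
  have h := hflat x ν μ
  simp only [finTorusPlaquette, hν, one_mul, inv_one, mul_one] at h
  exact mul_inv_eq_one.1 h

/-! ## §4 Ladder lemmas: loop holonomies do not feel transverse shifts -/

section Ladder

variable (U : FinTorusSite (m₀ + 1) (m₁ + 1) (m₂ + 1) (m₃ + 1) × Fin 4 → G)
  (hflat : ∀ x μ ν, finTorusPlaquette U x μ ν = 1)
include hflat

/-- Axis-`0` loop holonomy is invariant under the `1`-shift. -/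
theorem line₀_shift₁ (b : Fin (m₁ + 1)) (c : Fin (m₂ + 1)) (d : Fin (m₃ + 1)) :
    ∏ i : Fin (m₀ + 1), U ((i, b + 1, c, d), 0) = ∏ i : Fin (m₀ + 1), U ((i, b, c, d), 0) := by
  have key : ∏ i : Fin (m₀ + 1), finTorusPlaquette U (i, b, c, d) 0 1 = 1 := Finset.prod_eq_one fun i _ => hflat _ _ _
  simp only [finTorusPlaquette, shift_zero_eq, shift_one_eq, Finset.prod_mul_distrib, Finset.prod_inv_distrib] at key
  have hre : ∏ i : Fin (m₀ + 1), U ((i + 1, b, c, d), 1) = ∏ i : Fin (m₀ + 1), U ((i, b, c, d), 1) :=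
    Fintype.prod_equiv (Equiv.addRight 1) _ _ fun i => rfl
  exact (eq_of_plaquette_eq_one key hre).symm

/-- Axis-`0` loop holonomy is invariant under the `2`-shift. -/
theorem line₀_shift₂ (b : Fin (m₁ + 1)) (c : Fin (m₂ + 1)) (d : Fin (m₃ + 1)) :
    ∏ i : Fin (m₀ + 1), U ((i, b, c + 1, d), 0) = ∏ i : Fin (m₀ + 1), U ((i, b, c, d), 0) := by
  have key : ∏ i : Fin (m₀ + 1), finTorusPlaquette U (i, b, c, d) 0 2 = 1 := Finset.prod_eq_one fun i _ => hflat _ _ _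
  simp only [finTorusPlaquette, shift_zero_eq, shift_two_eq, Finset.prod_mul_distrib, Finset.prod_inv_distrib] at key
  have hre : ∏ i : Fin (m₀ + 1), U ((i + 1, b, c, d), 2) = ∏ i : Fin (m₀ + 1), U ((i, b, c, d), 2) :=
    Fintype.prod_equiv (Equiv.addRight 1) _ _ fun i => rfl
  exact (eq_of_plaquette_eq_one key hre).symm

/-- Axis-`0` loop holonomy is invariant under the `3`-shift. -/
theorem line₀_shift₃ (b : Fin (m₁ + 1)) (c : Fin (m₂ + 1)) (d : Fin (m₃ + 1)) :
    ∏ i : Fin (m₀ + 1), U ((i, b, c, d + 1), 0) = ∏ i : Fin (m₀ + 1), U ((i, b, c, d), 0) := by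
  have key : ∏ i : Fin (m₀ + 1), finTorusPlaquette U (i, b, c, d) 0 3 = 1 := Finset.prod_eq_one fun i _ => hflat _ _ _
  simp only [finTorusPlaquette, shift_zero_eq, shift_three_eq, Finset.prod_mul_distrib, Finset.prod_inv_distrib] at key
  have hre : ∏ i : Fin (m₀ + 1), U ((i + 1, b, c, d), 3) = ∏ i : Fin (m₀ + 1), U ((i, b, c, d), 3) :=
    Fintype.prod_equiv (Equiv.addRight 1) _ _ fun i => rfl
  exact (eq_of_plaquette_eq_one key hre).symm

/-- Axis-`1` loop holonomy is invariant under the `2`-shift. -/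
theorem line₁_shift₂ (a : Fin (m₀ + 1)) (c : Fin (m₂ + 1)) (d : Fin (m₃ + 1)) :
    ∏ i : Fin (m₁ + 1), U ((a, i, c + 1, d), 1) = ∏ i : Fin (m₁ + 1), U ((a, i, c, d), 1) := by
  have key : ∏ i : Fin (m₁ + 1), finTorusPlaquette U (a, i, c, d) 1 2 = 1 := Finset.prod_eq_one fun i _ => hflat _ _ _
  simp only [finTorusPlaquette, shift_one_eq, shift_two_eq, Finset.prod_mul_distrib, Finset.prod_inv_distrib] at key
  have hre : ∏ i : Fin (m₁ + 1), U ((a, i + 1, c, d), 2) = ∏ i : Fin (m₁ + 1), U ((a, i, c, d), 2) :=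
    Fintype.prod_equiv (Equiv.addRight 1) _ _ fun i => rfl
  exact (eq_of_plaquette_eq_one key hre).symm

/-- Axis-`1` loop holonomy is invariant under the `3`-shift. -/
theorem line₁_shift₃ (a : Fin (m₀ + 1)) (c : Fin (m₂ + 1)) (d : Fin (m₃ + 1)) :
    ∏ i : Fin (m₁ + 1), U ((a, i, c, d + 1), 1) = ∏ i : Fin (m₁ + 1), U ((a, i, c, d), 1) := by
  have key : ∏ i : Fin (m₁ + 1), finTorusPlaquette U (a, i, c, d) 1 3 = 1 := Finset.prod_eq_one fun i _ => hflat _ _ _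
  simp only [finTorusPlaquette, shift_one_eq, shift_three_eq, Finset.prod_mul_distrib, Finset.prod_inv_distrib] at key
  have hre : ∏ i : Fin (m₁ + 1), U ((a, i + 1, c, d), 3) = ∏ i : Fin (m₁ + 1), U ((a, i, c, d), 3) :=
    Fintype.prod_equiv (Equiv.addRight 1) _ _ fun i => rfl
  exact (eq_of_plaquette_eq_one key hre).symm

/-- Axis-`2` loop holonomy is invariant under the `3`-shift. -/
theorem line₂_shift₃ (a : Fin (m₀ + 1)) (b : Fin (m₁ + 1)) (d : Fin (m₃ + 1)) :
    ∏ i : Fin (m₂ + 1), U ((a, b, i, d + 1), 2) = ∏ i : Fin (m₂ + 1), U ((a, b, i, d), 2) := by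
  have key : ∏ i : Fin (m₂ + 1), finTorusPlaquette U (a, b, i, d) 2 3 = 1 := Finset.prod_eq_one fun i _ => hflat _ _ _
  simp only [finTorusPlaquette, shift_two_eq, shift_three_eq, Finset.prod_mul_distrib, Finset.prod_inv_distrib] at key
  have hre : ∏ i : Fin (m₂ + 1), U ((a, b, i + 1, d), 3) = ∏ i : Fin (m₂ + 1), U ((a, b, i, d), 3) :=
    Fintype.prod_equiv (Equiv.addRight 1) _ _ fun i => rfl
  exact (eq_of_plaquette_eq_one key hre).symm

end Ladder

/-! ## §5 A full line whose off-seam links are trivial: the seam link IS the holonomy -/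

/-- On `Fin (m+1)`: if `f i = 1` for every `i ≠ last`, then `∏ i, f i = f (last m)`. -/
theorem prod_eq_last_of_off_last {m : ℕ} (f : Fin (m + 1) → G) (h : ∀ i, i ≠ Fin.last m → f i = 1) :
    ∏ i, f i = f (Fin.last m) := by
  rw [Fin.prod_univ_castSucc, Finset.prod_eq_one fun i _ => h _ (Fin.castSucc_lt_last i).ne, one_mul]

/-! ## §6 PROPAGATION: a flat field trivial on the comb tree and on the four base seam links is trivial -/

/-- **Propagation of flatness along the comb.**  Let `U` be a gauge field on the `Fin`-torus `(m₀+1)×(m₁+1)×(m₂+1)×(m₃+1)` with values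
in an abelian group, all of whose plaquette holonomies are trivial.  If `U` is trivial on the comb spanning tree — the axis-`0` links
with `x₀ ≠ last`, the axis-`1` links with `x₀ = 0`, `x₁ ≠ last`, the axis-`2` links with `x₀ = x₁ = 0`, `x₂ ≠ last`, the axis-`3` links
with `x₀ = x₁ = x₂ = 0`, `x₃ ≠ last` — and on the four seam links of the base lines, then `U` is trivial.  (Injectivity half of
`#Flat = |G|^{V+3}`: a flat field is determined by its values on these `V + 3` links.) -/
theorem eq_one_of_flat_of_comb (U : FinTorusSite (m₀ + 1) (m₁ + 1) (m₂ + 1) (m₃ + 1) × Fin 4 → G)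
    (hflat : ∀ x μ ν, finTorusPlaquette U x μ ν = 1)
    (h0 : ∀ x : FinTorusSite (m₀ + 1) (m₁ + 1) (m₂ + 1) (m₃ + 1), x.1 ≠ Fin.last m₀ → U (x, 0) = 1)
    (h0s : U ((Fin.last m₀, 0, 0, 0), 0) = 1)
    (h1 : ∀ x : FinTorusSite (m₀ + 1) (m₁ + 1) (m₂ + 1) (m₃ + 1), x.1 = 0 → x.2.1 ≠ Fin.last m₁ → U (x, 1) = 1)
    (h1s : U ((0, Fin.last m₁, 0, 0), 1) = 1)
    (h2 : ∀ x : FinTorusSite (m₀ + 1) (m₁ + 1) (m₂ + 1) (m₃ + 1), x.1 = 0 → x.2.1 = 0 → x.2.2.1 ≠ Fin.last m₂ → U (x, 2) = 1)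
    (h2s : U ((0, 0, Fin.last m₂, 0), 2) = 1)
    (h3 : ∀ x : FinTorusSite (m₀ + 1) (m₁ + 1) (m₂ + 1) (m₃ + 1),
      x.1 = 0 → x.2.1 = 0 → x.2.2.1 = 0 → x.2.2.2 ≠ Fin.last m₃ → U (x, 3) = 1)
    (h3s : U ((0, 0, 0, Fin.last m₃), 3) = 1) :
    U = 1 := by
  -- Step 0: every axis-0 loop holonomy is trivial, hence every axis-0 link.
  have hl0 : ∀ b c d, ∏ i : Fin (m₀ + 1), U ((i, b, c, d), 0) = 1 := by
    have hb : ∀ b c d, ∏ i : Fin (m₀ + 1), U ((i, b, c, d), 0) = ∏ i : Fin (m₀ + 1), U ((i, 0, c, d), 0) := fun b c d =>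
      eq_of_forall_add_one (fun j => ∏ i : Fin (m₀ + 1), U ((i, j, c, d), 0)) (fun j => line₀_shift₁ U hflat j c d) b
    have hc : ∀ c d, ∏ i : Fin (m₀ + 1), U ((i, 0, c, d), 0) = ∏ i : Fin (m₀ + 1), U ((i, 0, 0, d), 0) := fun c d =>
      eq_of_forall_add_one (fun j => ∏ i : Fin (m₀ + 1), U ((i, 0, j, d), 0)) (fun j => line₀_shift₂ U hflat 0 j d) c
    have hd : ∀ d, ∏ i : Fin (m₀ + 1), U ((i, 0, 0, d), 0) = ∏ i : Fin (m₀ + 1), U ((i, 0, 0, 0), 0) := fun d =>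
      eq_of_forall_add_one (fun j => ∏ i : Fin (m₀ + 1), U ((i, 0, 0, j), 0)) (fun j => line₀_shift₃ U hflat 0 0 j) d
    have hbase : ∏ i : Fin (m₀ + 1), U ((i, 0, 0, 0), 0) = 1 := by
      rw [prod_eq_last_of_off_last _ fun i hi => h0 (i, 0, 0, 0) hi, h0s]
    intro b c d
    rw [hb, hc, hd, hbase]
  have hA0 : ∀ x, U (x, 0) = 1 := by
    rintro ⟨a, b, c, d⟩
    by_cases ha : a = Fin.last m₀
    · subst ha
      rw [← prod_eq_last_of_off_last (fun i => U ((i, b, c, d), 0)) fun i hi => h0 (i, b, c, d) hi]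
      exact hl0 b c d
    · exact h0 (a, b, c, d) ha
  -- Step 1: axis-1 links are invariant under the 0-shift, so reduce to the slice x₀ = 0, where the comb + seam + ladders decide.
  have hA1 : ∀ x, U (x, 1) = 1 := by
    have hinv : ∀ x, U (x.shift 0, 1) = U (x, 1) := fun x => apply_shift_eq_of_axis_trivial U hflat 0 hA0 x 1
    have hl1 : ∀ c d, ∏ i : Fin (m₁ + 1), U ((0, i, c, d), 1) = 1 := by
      have hc : ∀ c d, ∏ i : Fin (m₁ + 1), U ((0, i, c, d), 1) = ∏ i : Fin (m₁ + 1), U ((0, i, 0, d), 1) := fun c d =>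
        eq_of_forall_add_one (fun j => ∏ i : Fin (m₁ + 1), U ((0, i, j, d), 1)) (fun j => line₁_shift₂ U hflat 0 j d) c
      have hd : ∀ d, ∏ i : Fin (m₁ + 1), U ((0, i, 0, d), 1) = ∏ i : Fin (m₁ + 1), U ((0, i, 0, 0), 1) := fun d =>
        eq_of_forall_add_one (fun j => ∏ i : Fin (m₁ + 1), U ((0, i, 0, j), 1)) (fun j => line₁_shift₃ U hflat 0 0 j) d
      have hbase : ∏ i : Fin (m₁ + 1), U ((0, i, 0, 0), 1) = 1 := by
        rw [prod_eq_last_of_off_last _ fun i hi => h1 (0, i, 0, 0) rfl hi, h1s]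
      intro c d
      rw [hc, hd, hbase]
    have hslice : ∀ b c d, U ((0, b, c, d), 1) = 1 := by
      intro b c d
      by_cases hb : b = Fin.last m₁
      · subst hb
        rw [← prod_eq_last_of_off_last (fun i => U ((0, i, c, d), 1)) fun i hi => h1 (0, i, c, d) rfl hi]
        exact hl1 c d
      · exact h1 (0, b, c, d) rfl hb
    intro x
    rw [indep₀ (fun y => U (y, 1)) hinv x]
    exact hslice _ _ _
  -- Step 2: axis-2 links are invariant under the 0- and 1-shifts; reduce to x₀ = x₁ = 0.
  have hA2 : ∀ x, U (x, 2) = 1 := by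
    have hinv0 : ∀ x, U (x.shift 0, 2) = U (x, 2) := fun x => apply_shift_eq_of_axis_trivial U hflat 0 hA0 x 2
    have hinv1 : ∀ x, U (x.shift 1, 2) = U (x, 2) := fun x => apply_shift_eq_of_axis_trivial U hflat 1 hA1 x 2
    have hl2 : ∀ d, ∏ i : Fin (m₂ + 1), U ((0, 0, i, d), 2) = 1 := by
      have hd : ∀ d, ∏ i : Fin (m₂ + 1), U ((0, 0, i, d), 2) = ∏ i : Fin (m₂ + 1), U ((0, 0, i, 0), 2) := fun d =>
        eq_of_forall_add_one (fun j => ∏ i : Fin (m₂ + 1), U ((0, 0, i, j), 2)) (fun j => line₂_shift₃ U hflat 0 0 j) d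
      have hbase : ∏ i : Fin (m₂ + 1), U ((0, 0, i, 0), 2) = 1 := by
        rw [prod_eq_last_of_off_last _ fun i hi => h2 (0, 0, i, 0) rfl rfl hi, h2s]
      intro d
      rw [hd, hbase]
    have hslice : ∀ c d, U ((0, 0, c, d), 2) = 1 := by
      intro c d
      by_cases hc : c = Fin.last m₂
      · subst hc
        rw [← prod_eq_last_of_off_last (fun i => U ((0, 0, i, d), 2)) fun i hi => h2 (0, 0, i, d) rfl rfl hi]
        exact hl2 d
      · exact h2 (0, 0, c, d) rfl rfl hc
    intro x
    rw [indep₀ (fun y => U (y, 2)) hinv0 x, indep₁ (fun y => U (y, 2)) hinv1 (0, x.2.1, x.2.2.1, x.2.2.2)]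
    exact hslice _ _
  -- Step 3: axis-3 links are invariant under the 0-, 1-, 2-shifts; reduce to the base line, which is comb + seam.
  have hA3 : ∀ x, U (x, 3) = 1 := by
    have hinv0 : ∀ x, U (x.shift 0, 3) = U (x, 3) := fun x => apply_shift_eq_of_axis_trivial U hflat 0 hA0 x 3
    have hinv1 : ∀ x, U (x.shift 1, 3) = U (x, 3) := fun x => apply_shift_eq_of_axis_trivial U hflat 1 hA1 x 3
    have hinv2 : ∀ x, U (x.shift 2, 3) = U (x, 3) := fun x => apply_shift_eq_of_axis_trivial U hflat 2 hA2 x 3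
    have hbase : ∀ d, U ((0, 0, 0, d), 3) = 1 := by
      intro d
      by_cases hd : d = Fin.last m₃
      · subst hd; exact h3s
      · exact h3 (0, 0, 0, d) rfl rfl rfl hd
    intro x
    rw [indep₀ (fun y => U (y, 3)) hinv0 x, indep₁ (fun y => U (y, 3)) hinv1 (0, x.2.1, x.2.2.1, x.2.2.2),
      indep₂ (fun y => U (y, 3)) hinv2]
    exact hbase _
  funext ⟨x, μ⟩
  fin_cases μ
  · exact hA0 x
  · exact hA1 x
  · exact hA2 x
  · exact hA3 x

end Summit.QuantumFields.YangMills.Cruxes.IR.FreezingLimit
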